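import Literature.AlgebraicGeometry.Shioda1982.PicardNumberPrimePower
import Literature.AlgebraicGeometry.Shioda1982.StandardQuadrupleLetter
import Literature.AlgebraicGeometry.HodgeTheory.FermatHodgeLevelGlue
import HarnessLib

/-!
# No exceptional Hodge quadruple at the prime-power levels `2ᵏ`, `3ᵏ` (Shioda 1982, Thm. 6 (b), (c) — multiset form)

Everything PROVED (no named facts, no definitions). The multiset / Meyer–Neutsch form of
[Shioda1982PicardFermat, Thm. 6]: "(b) If `m = 3ⁿ` (`n ≥ 2`), then any indecomposable element `α` of
`𝔅²ₘ` with `GCD(α) = 1` … is a permutation of one of `γⱼ` … (c) If `m = 2ⁿ` (`n ≥ 4`), then any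
element of `𝔍²ₘ(1)` is a permutation of one of `αᵢ` or `βᵢ`" — proved in the tree for every `k ≥ 1`
as `exists_perm_gammaStd_lt`, `exists_perm_alphaStd_or_betaStd_lt` (`PicardNumberPrimePower`). HERE,
in the vocabulary of `ExceptionalQuadruples.lean` ([MeyerNeutsch1981Fermatquadrupel] standard
quadruples `L₁, L₂, L₃` and Ausnahmequadrupel):
* **`isStandardQuadruple_of_two_pow`** / **`not_isExceptionalQuadruple_two_pow`**: at `m = 2ᵏ` the
  multiset of values of an indecomposable primitive Hodge character is a unit multiple of `L₁` or
  `L₂`; `Δ(2ᵏ) = 0`.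
* **`isStandardQuadruple_of_three_pow`** / **`not_isExceptionalQuadruple_three_pow`**: at `m = 3ᵏ`
  it is a unit multiple of `L₃`; `Δ(3ᵏ) = 0`.
(Consistent with [MeyerNeutsch1981Fermatquadrupel, Tabelle 1]: no row `4, 8, 9, 16, 27, 32, 64, 81,
128`.) Used by the range statement `not_isExceptionalQuadruple_of_lt_631` (levels `243, 256, 512`).

HONEST FRAMING (cell `pub-hfermat`): explicit algebraic cycles for specific Hodge classes on
Fermat/Delsarte varieties; residual open instances listed; no claim on general Hodge. (Surface
classes are algebraic by Lefschetz (1,1); this file restates a proved classification of `𝔅²ₘ`.)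

## References
* [Shioda1982PicardFermat] T. Shioda, *On the Picard number of a Fermat surface*, J. Fac. Sci. Univ.
  Tokyo IA 28 (1982) 725–734 — Lemma 1 p. 728, Prop. 4 (Q′) p. 729, Thm. 6 (b), (c) p. 731.
* [MeyerNeutsch1981Fermatquadrupel] W. Meyer, W. Neutsch, Math. Ann. 256 (1981) 51–62 — (13)–(15)
  p. 53, Tabelle 1 p. 54.
-/

namespace Literature.AlgebraicGeometry.Shioda1982

open Finset Multiset Literature.AlgebraicGeometry.HodgeTheory Literature.AlgebraicGeometry.HodgeTheory.FermatCharacter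

section Helpers

variable {m : ℕ} [NeZero m]

omit [NeZero m] in
/-- Divisibility of Meyer–Neutsch's `gcd(a₁, …, a_k, m)` (a right fold of `Nat.gcd`). [folklore] -/
private theorem dvd_foldr_gcd₂₃ {d b : ℕ} {l : Multiset ℕ} (hb : d ∣ b) (hl : ∀ v ∈ l, d ∣ v) :
    d ∣ l.foldr Nat.gcd b := by
  induction l using Multiset.induction_on with
  | empty => simpa using hb
  | cons a l ih =>
    rw [Multiset.foldr_cons]
    exact Nat.dvd_gcd (hl a (Multiset.mem_cons_self a l)) (ih fun v hv ↦ hl v (Multiset.mem_cons_of_mem hv))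

omit [NeZero m] in
/-- A `4`-tuple whose multiset of values has no pair `a, -a` (as two members) is indecomposable. [folklore] -/
private theorem indecomposable_of_not_hasPair₂₃ {α : Fin 4 → ZMod m} (h : ¬ HasPair (univ.val.map α)) :
    ∀ i j : Fin 4, i ≠ j → α i + α j ≠ 0 := by
  classical
  intro i j hij hsum
  apply h
  refine ⟨α i, Multiset.mem_map.mpr ⟨i, Finset.mem_univ_val i, rfl⟩, ?_⟩
  have hneg : -α i = α j := by linear_combination (-1 : ZMod m) * hsum
  rw [hneg]
  by_cases he : α j = α i
  · have h2 : 2 ≤ Multiset.count (α i) (univ.val.map α) := by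
      rw [count_univ_val_map]
      exact Finset.one_lt_card.mpr ⟨i, by simp, j, by simp [he], hij⟩
    rw [he, ← Multiset.count_pos, Multiset.count_erase_self]
    omega
  · exact (Multiset.mem_erase_of_ne he).mpr (Multiset.mem_map.mpr ⟨j, Finset.mem_univ_val j, rfl⟩)

omit [NeZero m] in
/-- `∑ ⟨aᵢ⟩ = 2m` for a Hodge character of length `4`, and Meyer–Neutsch primitivity makes a common
divisor `g` of the `⟨aᵢ⟩` divide `2`. [cite: MeyerNeutsch1981Fermatquadrupel, (9)–(10) p. 52] -/
private theorem dvd_two_of_isPrimitive₂₃ {α : Fin 4 → ZMod m} (hα : IsHodge α)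
    (hp : IsPrimitive m (univ.val.map α)) {g : ℕ} (hg : ∀ i, g ∣ (α i).val) :
    (∑ i, (α i).val = 2 * m) ∧ Nat.Coprime g m ∧ g ∣ 2 := by
  have hsum : ∑ i, (α i).val = 2 * m := by
    have h1 := hα.2 1
    simp only [Units.val_one, one_mul] at h1
    change 2 * ∑ i, (α i).val = m * 4 at h1
    omega
  have hg4 : g ∣ 2 * m := hsum ▸ Finset.dvd_sum fun i _ ↦ hg i
  have hcop : Nat.Coprime g m := by
    have hd : Nat.gcd g m ∣ ((univ.val.map α).map ZMod.val).foldr Nat.gcd m := by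
      refine dvd_foldr_gcd₂₃ (Nat.gcd_dvd_right _ _) fun v hv ↦ ?_
      obtain ⟨a, ha, rfl⟩ := Multiset.mem_map.mp hv
      obtain ⟨i, -, rfl⟩ := Multiset.mem_map.mp ha
      exact (Nat.gcd_dvd_left _ _).trans (hg i)
    unfold IsPrimitive at hp
    rw [hp] at hd
    exact Nat.dvd_one.mp hd
  exact ⟨hsum, hcop, hcop.dvd_of_dvd_mul_right hg4⟩

omit [NeZero m] in
/-- At an EVEN level, Meyer–Neutsch primitivity of the multiset of values of a Hodge character gives
`GCD(⟨aᵢ⟩) = 1` (`g ∣ 2` and `g = 2` is not prime to `m`). [cite: MeyerNeutsch1981Fermatquadrupel, (9)–(10) p. 52] -/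
private theorem forall_dvd_of_isPrimitive_even₂₃ (h2 : 2 ∣ m) {α : Fin 4 → ZMod m} (hα : IsHodge α)
    (hp : IsPrimitive m (univ.val.map α)) : ∀ g : ℕ, (∀ i, g ∣ (α i).val) → g = 1 := by
  intro g hg
  obtain ⟨-, hcop, hg2⟩ := dvd_two_of_isPrimitive₂₃ hα hp hg
  have hg0 : g ≠ 0 := fun h ↦ by rw [h] at hg2; exact absurd (Nat.eq_zero_of_zero_dvd hg2) two_ne_zero
  have hgle : g ≤ 2 := Nat.le_of_dvd two_pos hg2
  interval_cases g
  · exact absurd rfl hg0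
  · rfl
  · exfalso
    have h2' : Nat.gcd 2 m = 2 := Nat.gcd_eq_left h2
    have h1 := Nat.Coprime.gcd_eq_one hcop
    rw [h2'] at h1
    exact absurd h1 (by norm_num)

/-- At an ODD level, Meyer–Neutsch primitivity of the multiset of values of a Hodge character gives
`GCD(⟨aᵢ⟩) = 1`: `g ∣ 2`, and `g = 2` would give `∑ ⟨2⁻¹aᵢ⟩ = m ≠ 2m`.
[cite: MeyerNeutsch1981Fermatquadrupel, (9)–(10) p. 52] -/
private theorem forall_dvd_of_isPrimitive_odd₂₃ (hm : Odd m) {α : Fin 4 → ZMod m} (hα : IsHodge α)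
    (hp : IsPrimitive m (univ.val.map α)) : ∀ g : ℕ, (∀ i, g ∣ (α i).val) → g = 1 := by
  intro g hg
  obtain ⟨hsum, -, hg2⟩ := dvd_two_of_isPrimitive₂₃ hα hp hg
  have hg0 : g ≠ 0 := fun h ↦ by rw [h] at hg2; exact absurd (Nat.eq_zero_of_zero_dvd hg2) two_ne_zero
  have hgle : g ≤ 2 := Nat.le_of_dvd two_pos hg2
  interval_cases g
  · exact absurd rfl hg0
  · rfl
  · exfalso
    have h2u : IsUnit (2 : ZMod m) := by
      rw [show (2 : ZMod m) = ((2 : ℕ) : ZMod m) by norm_cast, ZMod.isUnit_iff_coprime]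
      exact Nat.coprime_two_left.mpr hm
    set u : (ZMod m)ˣ := h2u.unit⁻¹ with hu
    have h2inv : (2 : ZMod m) * (u : ZMod m) = 1 := by rw [hu]; exact h2u.mul_val_inv
    have hhalf : ∀ i, ((u : ZMod m) * α i).val = (α i).val / 2 := by
      intro i
      obtain ⟨k, hk⟩ := hg i
      have hk' : (α i).val / 2 = k := by rw [hk]; simp
      have hklt : k < m := by
        have := ZMod.val_lt (α i)
        omega
      have e : (u : ZMod m) * α i = (k : ZMod m) := by
        have : α i = ((2 * k : ℕ) : ZMod m) := by rw [← hk, ZMod.natCast_zmod_val]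
        rw [this, Nat.cast_mul, Nat.cast_ofNat, ← mul_assoc, mul_comm (u : ZMod m), h2inv, one_mul]
      rw [e, ZMod.val_natCast, Nat.mod_eq_of_lt hklt, hk']
    have hu2 := hα.2 u
    unfold normSum at hu2
    simp only [hhalf] at hu2
    have hdiv : ∑ i, (α i).val / 2 = m := by
      have h2 : ∀ i, 2 * ((α i).val / 2) = (α i).val := fun i ↦ Nat.mul_div_cancel' (hg i)
      have : 2 * ∑ i, (α i).val / 2 = 2 * m := by
        rw [Finset.mul_sum, Finset.sum_congr rfl fun i _ ↦ h2 i, hsum]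
      omega
    have hm0 : m ≠ 0 := NeZero.ne m
    rw [hdiv] at hu2
    omega

omit [NeZero m] in
/-- Reindexing by a permutation does not change the multiset of values. [folklore] -/
private theorem univ_val_map_comp_perm₂₃ {X : Type*} (α : Fin 4 → X) (σ : Equiv.Perm (Fin 4)) :
    univ.val.map (fun l ↦ α (σ l)) = univ.val.map α := by
  rw [show (fun l ↦ α (σ l)) = α ∘ σ from rfl, ← Multiset.map_map, Multiset.map_univ_val_equiv]

/-- A unit `t` of `ℤ/m`, `3 ∣ m`, multiplies `m/3` into `m/3` or `2m/3`. [folklore] -/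
private theorem unit_mul_third₂₃ (h3 : 3 ∣ m) (t : (ZMod m)ˣ) :
    (t : ZMod m) * ((m / 3 : ℕ) : ZMod m) = ((m / 3 : ℕ) : ZMod m) ∨
      (t : ZMod m) * ((m / 3 : ℕ) : ZMod m) = 2 * ((m / 3 : ℕ) : ZMod m) := by
  have hcop : Nat.Coprime (t : ZMod m).val m := ZMod.val_coe_unit_coprime t
  have hK3 : (3 : ZMod m) * ((m / 3 : ℕ) : ZMod m) = 0 := by
    have : ((3 * (m / 3) : ℕ) : ZMod m) = 0 := by
      rw [Nat.mul_div_cancel' h3]; exact ZMod.natCast_self _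
    exact_mod_cast this
  have hr : (t : ZMod m).val % 3 = 1 ∨ (t : ZMod m).val % 3 = 2 := by
    have hne : (t : ZMod m).val % 3 ≠ 0 := fun h ↦ by
      have h0 : 3 ∣ (t : ZMod m).val := Nat.dvd_of_mod_eq_zero h
      have h31 : 3 ∣ Nat.gcd (t : ZMod m).val m := Nat.dvd_gcd h0 h3
      rw [Nat.Coprime.gcd_eq_one hcop] at h31
      exact absurd (Nat.le_of_dvd one_pos h31) (by norm_num)
    omega
  have key : (t : ZMod m) * ((m / 3 : ℕ) : ZMod m) =
      (((t : ZMod m).val % 3 : ℕ) : ZMod m) * ((m / 3 : ℕ) : ZMod m) := by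
    conv_lhs => rw [← ZMod.natCast_zmod_val (t : ZMod m), ← Nat.div_add_mod (t : ZMod m).val 3]
    push_cast
    linear_combination (((t : ZMod m).val / 3 : ℕ) : ZMod m) * hK3
  rcases hr with hr | hr
  · left; rw [key, hr]; push_cast; ring
  · right; rw [key, hr]; push_cast; ring

end Helpers

/-! ### The prime powers `2ᵏ`, `3ᵏ`: multiset form of [Shioda1982PicardFermat, Thm. 6 (b), (c)] -/

section PrimePowers

variable {k : ℕ}

/-- **At a level `m = 2ᵏ` the multiset of values of an indecomposable primitive Hodge character of
length `4` is a standard quadruple** — a unit multiple of `L₁ = (1, K, K+1, 2K−2)` (Shioda's `αᵢ`) or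
of `L₂ = (1, K+1, K+2, 2K−4)` (`βᵢ`), `K = m/2`: [Shioda1982PicardFermat, Thm. 6 (c)] (there for
`n ≥ 4`; `exists_perm_alphaStd_or_betaStd_lt` for every `k ≥ 1`) in the vocabulary of
[MeyerNeutsch1981Fermatquadrupel]. [cite: Shioda1982PicardFermat, Thm. 6 (c) p. 731, Lemma 1 (a) p. 728] [cite: MeyerNeutsch1981Fermatquadrupel, (13)–(14) p. 53] -/
theorem isStandardQuadruple_of_two_pow (hk : 0 < k) {α : Fin 4 → ZMod (2 ^ k)} (hα : IsHodge α)
    (hind : ∀ i j : Fin 4, i ≠ j → α i + α j ≠ 0) (hprim : ∀ g : ℕ, (∀ i, g ∣ (α i).val) → g = 1) :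
    IsStandardQuadruple (2 ^ k) (univ.val.map α) := by
  classical
  obtain ⟨i, σ, -, -, hodd, hshape⟩ := exists_perm_alphaStd_or_betaStd_lt hk hα hind hprim
  have h2 : 2 ∣ 2 ^ k := dvd_pow_self 2 hk.ne'
  have hio : Odd i := Nat.not_even_iff_odd.mp (by rwa [even_iff_two_dvd])
  have hcop : Nat.Coprime i (2 ^ k) := (Nat.coprime_two_right.mpr hio).pow_right k
  set t : (ZMod (2 ^ k))ˣ := ZMod.unitOfCoprime i hcop with ht
  have htc : (t : ZMod (2 ^ k)) = (i : ZMod (2 ^ k)) := ZMod.coe_unitOfCoprime i hcop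
  obtain ⟨H, hH⟩ : ∃ H : ZMod (2 ^ k), H = ((2 ^ k / 2 : ℕ) : ZMod (2 ^ k)) := ⟨_, rfl⟩
  have h22 : 2 * (2 ^ k / 2) = 2 ^ k := Nat.mul_div_cancel' h2
  have hHH : H + H = 0 := by
    rw [hH, ← Nat.cast_add, ← two_mul, h22, ZMod.natCast_self]
  have hiH : (i : ZMod (2 ^ k)) * H = H := by rw [← htc, hH, mul_comm]; exact half_mul_unit h2 t
  have perm : univ.val.map α = univ.val.map (fun l ↦ α (σ l)) :=
    (univ_val_map_comp_perm₂₃ α σ).symm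
  rcases hshape with hA | hB
  · -- `α ∼ α_i = (i, K + i, −2i, K) = i · L₁`
    have e : univ.val.map α =
        {(i : ZMod (2 ^ k)), H + (i : ZMod (2 ^ k)), -(2 * (i : ZMod (2 ^ k))), H} := by
      rw [perm, show (fun l ↦ α (σ l)) = alphaStd (i : ZMod (2 ^ k)) from funext hA, hH]
      simp [alphaStd, Fin.univ_val_map]
      rfl
    refine ⟨t, Or.inl ⟨h2, Or.inl ?_⟩⟩
    rw [e, stdOne]
    simp only [Multiset.insert_eq_cons, Multiset.map_cons, Multiset.map_singleton, mul_one, htc, ← hH]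
    rw [hiH, show (i : ZMod (2 ^ k)) * (H + 1) = H + i by rw [mul_add, hiH, mul_one],
      show (i : ZMod (2 ^ k)) * (2 * H - 2) = -(2 * i) by linear_combination (i : ZMod (2 ^ k)) * hHH]
    simp only [← Multiset.singleton_add]
    abel
  · -- `α ∼ β_i = (i, K + i, K + 2i, −4i) = i · L₂`
    have e : univ.val.map α =
        {(i : ZMod (2 ^ k)), H + (i : ZMod (2 ^ k)), H + 2 * (i : ZMod (2 ^ k)),
          -(4 * (i : ZMod (2 ^ k)))} := by
      rw [perm, show (fun l ↦ α (σ l)) = betaStd (i : ZMod (2 ^ k)) from funext hB, hH]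
      simp [betaStd, Fin.univ_val_map]
      rfl
    refine ⟨t, Or.inl ⟨h2, Or.inr ?_⟩⟩
    rw [e, stdTwo]
    simp only [Multiset.insert_eq_cons, Multiset.map_cons, Multiset.map_singleton, mul_one, htc, ← hH]
    rw [show (i : ZMod (2 ^ k)) * (H + 1) = H + i by rw [mul_add, hiH, mul_one],
      show (i : ZMod (2 ^ k)) * (H + 2) = H + 2 * i by rw [mul_add, hiH]; ring,
      show (i : ZMod (2 ^ k)) * (2 * H - 4) = -(4 * i) by linear_combination (i : ZMod (2 ^ k)) * hHH]

/-- **`Δ(2ᵏ) = 0`: no exceptional quadruple at a level `2ᵏ`, `k ≥ 1`** ([MeyerNeutsch1981Fermatquadrupel,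
Tabelle 1] has no row `4, 8, …, 128`; [Shioda1982PicardFermat, Thm. 6 (c)]).
[cite: Shioda1982PicardFermat, Thm. 6 (c) p. 731] [cite: MeyerNeutsch1981Fermatquadrupel, p. 53 (Standard- und Ausnahmequadrupel)] -/
theorem not_isExceptionalQuadruple_two_pow (hk : 0 < k) (s : Multiset (ZMod (2 ^ k))) :
    ¬ IsExceptionalQuadruple (2 ^ k) s := by
  rintro ⟨h4, hs, hnp, hprim, hns⟩
  obtain ⟨r, α, rfl⟩ := exists_eq_univ_val_map s
  have hr : r = 4 := by rw [card_univ_val_map] at h4; exact h4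
  subst hr
  have hα : IsHodge α := (isHodge_iff_isHodgeMultiset α).2 hs
  exact hns (isStandardQuadruple_of_two_pow hk hα (indecomposable_of_not_hasPair₂₃ hnp)
    (forall_dvd_of_isPrimitive_even₂₃ (dvd_pow_self 2 hk.ne') hα hprim))

/-- **At a level `m = 3ᵏ` the multiset of values of an indecomposable primitive Hodge character of
length `4` is a standard quadruple** — a unit multiple of `L₃ = (1, K'+1, 2K'+1, 3K'−3)` (Shioda's
`γⱼ`), `K' = m/3`: [Shioda1982PicardFermat, Thm. 6 (b)] (`exists_perm_gammaStd_lt`, every `k ≥ 1`).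
[cite: Shioda1982PicardFermat, Thm. 6 (b) p. 731, Lemma 1 (b) p. 728] [cite: MeyerNeutsch1981Fermatquadrupel, (15) p. 53] -/
theorem isStandardQuadruple_of_three_pow (hk : 0 < k) {α : Fin 4 → ZMod (3 ^ k)} (hα : IsHodge α)
    (hind : ∀ i j : Fin 4, i ≠ j → α i + α j ≠ 0) (hprim : ∀ g : ℕ, (∀ i, g ∣ (α i).val) → g = 1) :
    IsStandardQuadruple (3 ^ k) (univ.val.map α) := by
  classical
  obtain ⟨j, σ, -, -, h3j, hshape⟩ := exists_perm_gammaStd_lt hk hα hind hprim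
  have h3 : 3 ∣ 3 ^ k := dvd_pow_self 3 hk.ne'
  have hcop : Nat.Coprime j (3 ^ k) :=
    ((Nat.Prime.coprime_iff_not_dvd Nat.prime_three).mpr h3j).symm.pow_right k
  set t : (ZMod (3 ^ k))ˣ := ZMod.unitOfCoprime j hcop with ht
  have htc : (t : ZMod (3 ^ k)) = (j : ZMod (3 ^ k)) := ZMod.coe_unitOfCoprime j hcop
  obtain ⟨D, hD⟩ : ∃ D : ZMod (3 ^ k), D = ((3 ^ k / 3 : ℕ) : ZMod (3 ^ k)) := ⟨_, rfl⟩
  have h3D : (3 : ZMod (3 ^ k)) * D = 0 := by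
    have : ((3 * (3 ^ k / 3) : ℕ) : ZMod (3 ^ k)) = 0 := by
      rw [Nat.mul_div_cancel' h3]; exact ZMod.natCast_self _
    rw [hD]; exact_mod_cast this
  have perm : univ.val.map α = univ.val.map (fun l ↦ α (σ l)) :=
    (univ_val_map_comp_perm₂₃ α σ).symm
  have e : univ.val.map α =
      {(j : ZMod (3 ^ k)), D + (j : ZMod (3 ^ k)), 2 * D + (j : ZMod (3 ^ k)),
        -(3 * (j : ZMod (3 ^ k)))} := by
    rw [perm, show (fun l ↦ α (σ l)) = gammaStd (j : ZMod (3 ^ k)) from funext hshape, hD]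
    simp [gammaStd, Fin.univ_val_map]
    rfl
  refine ⟨t, Or.inr ⟨h3, ?_⟩⟩
  rcases unit_mul_third₂₃ h3 t with hjD | hjD <;> rw [htc, ← hD] at hjD
  · rw [e, stdThree]
    simp only [Multiset.insert_eq_cons, Multiset.map_cons, Multiset.map_singleton, mul_one, htc, ← hD]
    rw [show (j : ZMod (3 ^ k)) * (D + 1) = D + j by rw [mul_add, hjD, mul_one],
      show (j : ZMod (3 ^ k)) * (2 * D + 1) = 2 * D + j by linear_combination 2 * hjD,
      show (j : ZMod (3 ^ k)) * (3 * D - 3) = -(3 * j) by linear_combination 3 * hjD + h3D]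
  · rw [e, stdThree]
    simp only [Multiset.insert_eq_cons, Multiset.map_cons, Multiset.map_singleton, mul_one, htc, ← hD]
    rw [show (j : ZMod (3 ^ k)) * (D + 1) = 2 * D + j by rw [mul_add, hjD, mul_one],
      show (j : ZMod (3 ^ k)) * (2 * D + 1) = D + j by linear_combination 2 * hjD + h3D,
      show (j : ZMod (3 ^ k)) * (3 * D - 3) = -(3 * j) by linear_combination 3 * hjD + 2 * h3D]
    simp only [← Multiset.singleton_add]
    abel

/-- **`Δ(3ᵏ) = 0`: no exceptional quadruple at a level `3ᵏ`, `k ≥ 1`** ([Shioda1982PicardFermat,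
Thm. 6 (b)]; no row `9, 27, 81` in [MeyerNeutsch1981Fermatquadrupel, Tabelle 1]).
[cite: Shioda1982PicardFermat, Thm. 6 (b) p. 731] [cite: MeyerNeutsch1981Fermatquadrupel, p. 53 (Standard- und Ausnahmequadrupel)] -/
theorem not_isExceptionalQuadruple_three_pow (hk : 0 < k) (s : Multiset (ZMod (3 ^ k))) :
    ¬ IsExceptionalQuadruple (3 ^ k) s := by
  rintro ⟨h4, hs, hnp, hprim, hns⟩
  obtain ⟨r, α, rfl⟩ := exists_eq_univ_val_map s
  have hr : r = 4 := by rw [card_univ_val_map] at h4; exact h4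
  subst hr
  have hα : IsHodge α := (isHodge_iff_isHodgeMultiset α).2 hs
  exact hns (isStandardQuadruple_of_three_pow hk hα (indecomposable_of_not_hasPair₂₃ hnp)
    (forall_dvd_of_isPrimitive_odd₂₃ (Odd.pow (by decide)) hα hprim))

end PrimePowers

end Literature.AlgebraicGeometry.Shioda1982
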